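import Mathlib
import Summits.Ventures.PercRepro2.Defs
import Summits.Ventures.PercRepro2.Graph
import Summits.Ventures.PercRepro2.OneColourSwitch
import Summits.Ventures.PercRepro2.RegionHubSign
import Summits.Ventures.PercRepro2.SideSwitch
import Summits.Ventures.PercRepro2.SideSwitchFibre
import Summits.Ventures.PercRepro2.SideSwitchClosed
import Summits.Ventures.PercRepro2.SideSwitchComps
import Summits.Ventures.PercRepro2.SideSwitchCompsFibre
import Summits.Ventures.PercRepro2.M9NoPocketDefs
import Summits.Ventures.PercRepro2.M9NoPocketWorld
import Summits.Ventures.PercRepro2.M9NoPocketWorldD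
import Summits.Ventures.PercRepro2.M9NoPocketFibre
import Summits.Ventures.PercRepro2.M9PocketUnit
import Summits.Ventures.PercRepro2.M9PocketPsi2

/-!
# The clean partner `Ψ₂` lies in the unit (blind cell PercRepro2, p3 g39, 2026-08-29;
`proofs/P3-POCKETRK.md` §5′ Step 1 and §9 K6, part 3)

Setting of `M9PocketPsi2` (a doubly reached point `ω`, a closed set `C` of `Y`-side blocks).
The worlds of `{r, s}` in `G − d` are the same at `ω` and `Ψ₂ ω` (`U2_endsD_psi2`), and on
every edge touching them the normalisations `nu` of `G − d` agree (`nu_endsD_psi2_eq`): an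
edge touching `C` is unchanged and touches neither `W`-side (the blocks of `C` are closed in
the sided set); an edge not touching `C` is flipped, and it touches the `W`-side of exactly one
of the two colourings (the `W`-side of `Ψ₂ ω` is the `Y`-side of `ω` outside `C`).  Hence
**`Ψ₂ ω` lies in the unit of `ω`** in the sense of `M9PocketUnitSum` (the unit predicate
`∀ e ∈ touches (endsD ends d) (K₂ ∪ M₂), nu (endsD ends d) r s · e = ρ₀ e` holds at `Ψ₂ ω` iff
it holds at `ω`: `unit_psi2_iff`).  Own work; std axioms.
-/

namespace Summit.Ventures.PercRepro2

namespace NoPocket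

open Finset Classical OneColourSwitch SideSwitch

variable {V : Type*} {E : Type*} [Fintype V] [DecidableEq V] {ends : E → Sym2 V}
  {p q r s d : V} {ω : Config E} {C : Set V}

variable (hdr : d ≠ r) (hds : d ≠ s) (hrs : within ends ({r, s} : Set V) = ∅)
  (hsep : sep2 ends p q r s ω) (hD : DOne ends r s d ω)
  (hC : C ⊆ K2 (endsD ends d) r s ω) (hCr : r ∉ C) (hCs : s ∉ C)
  (hcl : ClosedIn (endsD ends d) (sided (endsD ends d) r s ω) C)

include hdr hds hsep hD hC hCr hCs hcl in
omit [Fintype V] [DecidableEq V] in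
/-- The worlds of `{r, s}` in `G − d` are the same at `ω` and `Ψ₂ ω`. -/
lemma U2_endsD_psi2 :
    K2 (endsD ends d) r s (fun e => if e ∈ touches ends C then ω e else !ω e) ∪
      M2 (endsD ends d) r s (fun e => if e ∈ touches ends C then ω e else !ω e) =
      K2 (endsD ends d) r s ω ∪ M2 (endsD ends d) r s ω := by
  rw [K2_endsD_psi2 hdr hds hsep hD hC hCr hCs hcl, M2_endsD_psi2 hdr hds hsep hD hC hCr hCs hcl]
  ext x
  simp only [Set.mem_union, Set.mem_sdiff]
  constructor
  · rintro ((h | h) | ⟨h, _⟩)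
    · exact Or.inr h
    · exact Or.inl (hC h)
    · exact Or.inl h
  · rintro (h | h)
    · by_cases hxC : x ∈ C
      · exact Or.inl (Or.inr hxC)
      · exact Or.inr ⟨h, hxC⟩
    · exact Or.inl (Or.inl h)

include hdr hds hrs hsep hD hC hCr hCs hcl in
/-- **On the edges touching the worlds of `{r, s}` in `G − d`, the normalisations of `ω` and
`Ψ₂ ω` agree.** -/
lemma nu_endsD_psi2_eq {e : E}
    (he : e ∈ touches (endsD ends d) (K2 (endsD ends d) r s ω ∪ M2 (endsD ends d) r s ω)) :
    nu (endsD ends d) r s (fun e => if e ∈ touches ends C then ω e else !ω e) e =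
      nu (endsD ends d) r s ω e := by
  have hde : d ∉ ends e := d_notMem_of_mem_touches_U2 hdr hds he
  have hsepD := sep2_endsD_of_sep2 (d := d) hsep
  have hDz := DZero_endsD_of_DOne hdr hds hD
  have hM2' := M2_endsD_psi2 hdr hds hsep hD hC hCr hCs hcl
  have hT' : ∀ S : Set V, e ∈ touches (endsD ends d) S ↔ e ∈ touches ends S :=
    fun S => mem_touches_endsD_iff hde
  -- the `W`-sides, as membership conditions
  have hB' : ∀ z, z ∈ Bside (endsD ends d) r s
      (fun e => if e ∈ touches ends C then ω e else !ω e) ↔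
      z ∈ K2 (endsD ends d) r s ω ∧ z ∉ C ∧ z ≠ r ∧ z ≠ s := by
    intro z
    rw [mem_Bside, hM2', Set.mem_sdiff]
    tauto
  have hB : ∀ z, z ∈ Bside (endsD ends d) r s ω ↔
      z ∈ M2 (endsD ends d) r s ω ∧ z ≠ r ∧ z ≠ s := fun z => mem_Bside
  -- no edge joins a `Y`-side sided vertex to a `W`-side sided vertex
  have hopp : ∀ z w, ends e = s(z, w) → z ∈ K2 (endsD ends d) r s ω → z ≠ r → z ≠ s →
      w ∈ M2 (endsD ends d) r s ω → w ≠ r → w ≠ s → False := by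
    intro z w hzw hzK hzr hzs hwM hwr hws
    cases h : ω e
    · exact hDz z hzr hzs hzK
        (mem_M2_of_closed hwM h (by rw [endsD_of_notMem hde, hzw, Sym2.eq_swap]))
    · exact hDz w hwr hws (mem_K2_of_open hzK h (by rw [endsD_of_notMem hde, hzw])) hwM
  obtain ⟨x, hxU, y, hxy⟩ := he
  rw [endsD_of_notMem hde] at hxy
  simp only [nu]
  by_cases htC : e ∈ touches ends C
  · -- the edge touches `C`: unchanged, and it touches neither `W`-side
    obtain ⟨c, hc, c', hcc'⟩ := htC
    have hnB' : e ∉ touches (endsD ends d)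
        (↑(Bside (endsD ends d) r s (fun e => if e ∈ touches ends C then ω e else !ω e)) :
          Set V) := by
      rw [hT']
      rintro ⟨z, hz, w, hzw⟩
      rw [Finset.mem_coe, hB'] at hz
      obtain ⟨hzK, hzC, hzr, hzs⟩ := hz
      rw [hzw, Sym2.eq_iff] at hcc'
      rcases hcc' with ⟨h1, _⟩ | ⟨_, h2⟩
      · exact hzC (h1 ▸ hc)
      · have hwC : w ∈ C := by rw [h2]; exact hc
        exact hzC (hcl e w z (by rw [endsD_of_notMem hde, hzw, Sym2.eq_swap]) hwC
          ⟨Or.inl hzK, hzr, hzs⟩)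
    have hnB : e ∉ touches (endsD ends d) (↑(Bside (endsD ends d) r s ω) : Set V) := by
      rw [hT']
      rintro ⟨z, hz, w, hzw⟩
      rw [Finset.mem_coe, hB] at hz
      obtain ⟨hzM, hzr, hzs⟩ := hz
      rw [hzw, Sym2.eq_iff] at hcc'
      rcases hcc' with ⟨h1, _⟩ | ⟨_, h2⟩
      · exact notMem_M2_endsD_of_mem_C hdr hds hD hC hCr hCs hc (h1 ▸ hzM)
      · have hwC : w ∈ C := by rw [h2]; exact hc
        exact hopp w z (by rw [hzw, Sym2.eq_swap]) (hC hwC) (fun h => hCr (h ▸ hwC))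
          (fun h => hCs (h ▸ hwC)) hzM hzr hzs
    rw [flipTouch_of_notMem _ hnB', flipTouch_of_notMem _ hnB]
    exact psi2_of_mem ⟨c, hc, c', hcc'⟩
  · -- the edge is flipped: it touches the `W`-side of exactly one of the two colourings
    by_cases hBω : e ∈ touches (endsD ends d) (↑(Bside (endsD ends d) r s ω) : Set V)
    · have hnB' : e ∉ touches (endsD ends d)
          (↑(Bside (endsD ends d) r s (fun e => if e ∈ touches ends C then ω e else !ω e)) :
            Set V) := by
        rw [hT']
        rintro ⟨z, hz, w, hzw⟩
        rw [Finset.mem_coe, hB'] at hz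
        obtain ⟨hzK, hzC, hzr, hzs⟩ := hz
        rw [hT'] at hBω
        obtain ⟨z', hz', w', hz'w'⟩ := hBω
        rw [Finset.mem_coe, hB] at hz'
        obtain ⟨hz'M, hz'r, hz's⟩ := hz'
        rw [hzw, Sym2.eq_iff] at hz'w'
        rcases hz'w' with ⟨h1, _⟩ | ⟨_, h2⟩
        · exact hDz z hzr hzs hzK (h1 ▸ hz'M)
        · have hwM : w ∈ M2 (endsD ends d) r s ω := by rw [h2]; exact hz'M
          have hwr : w ≠ r := by rw [h2]; exact hz'r
          have hws : w ≠ s := by rw [h2]; exact hz's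
          exact hopp z w hzw hzK hzr hzs hwM hwr hws
      rw [flipTouch_of_mem _ hBω, flipTouch_of_notMem _ hnB']
      exact psi2_of_notMem htC
    · -- `x` is `Y`-side (a `W`-side endpoint would be a vertex of `Bside ω`)
      have hxK : x ∈ K2 (endsD ends d) r s ω := by
        rcases hxU with h | h
        · exact h
        · by_cases hxr : x = r
          · subst hxr; exact r_mem_K2 x s ω
          by_cases hxs : x = s
          · subst hxs; exact s_mem_K2 r x ω
          exact (hBω ((hT' _).2 ⟨x, Finset.mem_coe.2 ((hB x).2 ⟨h, hxr, hxs⟩), y, hxy⟩)).elim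
      have hxC : x ∉ C := fun h => htC (mem_touches_of_ends hxy (Or.inl h))
      by_cases hxrs : x = r ∨ x = s
      · -- then `y` is a `Y`-side sided vertex outside `C`
        have hyrs : ¬ (y = r ∨ y = s) := by
          intro hy
          have : e ∈ within ends ({r, s} : Set V) := by
            refine ⟨x, ?_, y, ?_, hxy⟩
            · rcases hxrs with rfl | rfl <;> simp
            · rcases hy with rfl | rfl <;> simp
          rw [hrs] at this
          exact this
        have hyU := mem_U2_endsD_of_edge_rs hsepD hde hxy hxrs
        have hyK : y ∈ K2 (endsD ends d) r s ω := by
          rcases hyU with h | h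
          · exact h
          · exact (hBω ((hT' _).2 ⟨y, Finset.mem_coe.2 ((hB y).2
              ⟨h, fun h' => hyrs (Or.inl h'), fun h' => hyrs (Or.inr h')⟩), x,
              by rw [hxy, Sym2.eq_swap]⟩)).elim
        have hyC : y ∉ C := fun h => htC (mem_touches_of_ends hxy (Or.inr h))
        have hB'y : e ∈ touches (endsD ends d)
            (↑(Bside (endsD ends d) r s (fun e => if e ∈ touches ends C then ω e else !ω e)) :
              Set V) :=
          (hT' _).2 ⟨y, Finset.mem_coe.2 ((hB' y).2 ⟨hyK, hyC, fun h => hyrs (Or.inl h),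
            fun h => hyrs (Or.inr h)⟩), x, by rw [hxy, Sym2.eq_swap]⟩
        rw [flipTouch_of_mem _ hB'y, flipTouch_of_notMem _ hBω]
        simp only [psi2_of_notMem htC, Bool.not_not]
      · have hB'x : e ∈ touches (endsD ends d)
            (↑(Bside (endsD ends d) r s (fun e => if e ∈ touches ends C then ω e else !ω e)) :
              Set V) :=
          (hT' _).2 ⟨x, Finset.mem_coe.2 ((hB' x).2 ⟨hxK, hxC, fun h => hxrs (Or.inl h),
            fun h => hxrs (Or.inr h)⟩), y, hxy⟩
        rw [flipTouch_of_mem _ hB'x, flipTouch_of_notMem _ hBω]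
        simp only [psi2_of_notMem htC, Bool.not_not]

include hdr hds hrs hsep hD hC hCr hCs hcl in
/-- **`Ψ₂ ω` lies in the unit of `ω`**: the unit predicate of `M9PocketUnitSum` holds at
`Ψ₂ ω` iff it holds at `ω`. -/
lemma unit_psi2_iff (ρ₀ : Config E) :
    (∀ e ∈ touches (endsD ends d)
        (K2 (endsD ends d) r s (fun e => if e ∈ touches ends C then ω e else !ω e) ∪
          M2 (endsD ends d) r s (fun e => if e ∈ touches ends C then ω e else !ω e)),
        nu (endsD ends d) r s (fun e => if e ∈ touches ends C then ω e else !ω e) e = ρ₀ e) ↔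
      (∀ e ∈ touches (endsD ends d) (K2 (endsD ends d) r s ω ∪ M2 (endsD ends d) r s ω),
        nu (endsD ends d) r s ω e = ρ₀ e) := by
  rw [U2_endsD_psi2 hdr hds hsep hD hC hCr hCs hcl]
  exact forall₂_congr fun e he => by
    rw [nu_endsD_psi2_eq hdr hds hrs hsep hD hC hCr hCs hcl he]

end NoPocket

end Summit.Ventures.PercRepro2
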